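/-
Copyright: cell `pub-ymgap` (HUMAN RULING D-0062), Track A of `YM-PLAN.md`, DAG node N20 (= NE7b); R134 acceleration seat
`pub-ymgap-dag-n20-c` (strategy s1, generation 6), module 35.  Released under the licence of the surrounding project.
-/
import Summits.QuantumFields.YangMills.Theorems.BalabanUVNodesN20LCSLabelTowerAtResidualOfRecord
import Summits.QuantumFields.YangMills.Theorems.BalabanUVNodesN20LCSLabelTowerPinnedLevels
import HarnessLib

/-!
# YM-DAG node N20 (= NE7b), strategy s1, module 35: THE (α)-ROAD's HALVES AND CLASS WEIGHT BOUNDS ON BAŁABAN's LABEL TOWER AT THE RESIDUAL OF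
# RECORD `ζ := Node00.zeta316OfRecord A₁` — modules 28 §2–§4, 29 §3 and 32 with the two ζ-laws and the (O4) measurability STRUCK (theorems of the
# tree at the residual of record, module 34): `PointwiseExtraction ∧ LocCondStability` for (3.2)-pinned keys rooted at step 0 modulo ONLY the per-cube
# regularity letter; at pinned levels `j ≥ 1` modulo that letter and «LCS-j»

Track A of `YM-PLAN.md` (cell `pub-ymgap`, HUMAN RULING D-0062), node **N20** = spine estimate NE7b (`T4WeightBudget.RelWeightBound` — NOT PRINTED,
NOT PROVED).  Seat `pub-ymgap-dag-n20-c` (R134, s1 «the `LocCondStability` INSTANCE for Bałaban's tower at a pinned 𝐑𝐓 step»), generation 6, module 35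
(after module 34 `…N20LCSLabelTowerAtResidualOfRecord` = the letters discharged + the rows).  Kernel theorems only: 0 `def`, 0 `sorry`, standard axioms;
COUNT-NEUTRAL; `--supports` the K3⁗ item.  Nothing of Bałaban's is asserted.

WHY ∕ WHAT.  Module 34 records that at K0b's residual of record the lineage's three displayed letters are theorems (`isZetaUnity_zeta316OfRecord`,
`isZetaAbsLeOne_zeta316OfRecord`; `measurable_ωOfRecord_rec` from def-R's `localBgMeasurable`).  THIS FILE supplies them to the (α)-road's HALVES and CLASS
WEIGHT BOUNDS on the label tower (suffix `_rec`; every proof a specialisation of the cited theorem):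
* §1 KEYS ROOTED AT STEP 0 (`ρ₀ = rhoZeroOfRecord g₀ E₀`, `g₀⁻² ≥ 4N`): ★★★ **`halves_rec_rootedAtZero`** — `PointwiseExtraction ∧ LocCondStability` ON BAŁABAN's
  LABEL TOWER AT THE RESIDUAL OF RECORD, at every cutoff, with NO law ∕ measurability letter (module 28 §3); ★★ `sum_admS_integral_le_rec_rootedAtZero` (one
  Peierls factor per pinned cube, module 28 §2), `…_le_mul_sum_adm_rec_rootedAtZero` (END2's `extractA` shape), `…_rec_rootedAtZero_of_overlap` (module 28 §4),
  `integral_sum_pullAlong_le_rec_rootedAtZero` (by value, module 29 §3).  The ONLY displayed analytic input left in §1 is the per-cube regularity letter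
  `hreg` ([Balaban1985Variational] Thm 1 shape; K0's `VariationalThm1RegSep*` facts) — plus the geometric side conditions (disjoint ∕ boundedly overlapping
  letter regions, `m ≥ 1`, `ε″ ≥ 0`).
* §2 PINNED LEVELS (module 32): `halves_rec_pinnedLevels`, `sum_admS_integral_le_rec_pinnedLevels` (`≤ (Π_{j<K′, j∈J} rate j)·∫ρ₀ dU₀`), and the sanity
  `sum_admS_integral_free_eq_rec` (free pattern: equality, no hypothesis at all) — «LCS-j» (`hLS`, module 22's moment form) at pinned levels `j ≥ 1` STAYS:
  THE wall ((A1c)); n20-d's by-value twin (`…N20ByValue*`) carries level-dependent constants instead.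
* §3 ★★★ **`sum_admS_integral_le_rec_pinnedLevels_of_LCS_pos`** — THE WALL ISOLATED: in the state of record `rhoZeroOfRecord g₀ E₀` (`g₀⁻² ≥ 4N`) the level-`0`
  moment letters are FIXED to g2's «LCS-0» of record (`β 0 = g₀⁻²`, `a₀ 0 = 1∕12`, `C 0 = C₀`) and discharged INSIDE (module 32's `lcs_zero_labelTower_of_record`), so
  the multi-level class weight bound displays «LCS-j» for the pinned levels `j ≥ 1` ONLY — together with `hreg` and numeric side conditions, NOTHING ELSE.

HONEST FRAMING.  A RE-KEYING, not mathematics (module 34's framing applies verbatim).  BY-NAME EFFECT: the two named `Prop`s of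
`Spine/NE7b/LocalConditionalStability` are INHABITED on the object of record for (3.2)-pinned keys rooted at step 0 modulo `hreg` only; N20's first missing
estimate is, by name and with nothing else displayed, «LCS-j» β-∕level-uniform at pinned levels `j ≥ 1`.  NOT touched: the 𝐑-step; the key-pattern READING
(planners); `hreg`.  NE7b NOT PRINTED ∕ NOT PROVED; (α)-instance 0∕1; N20 NOT discharged; typed 28∕28, discharged count untouched; one finite four-torus at
fixed `ε` — NOT ℝ⁴, NOT infinite volume, NOT OS, NOT a mass gap, NOT Clay.

References (LOCATORS): T. Bałaban, CMP 119 (1988) 243–285 [Balaban1988Convergent] ((3.2)–(3.5) p. 265, (3.16) p. 268, (3.20)–(3.21) p. 269); CMP 122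
(1989) 175–202 [Balaban1989LargeFieldI] ((0.1) p. 175, (1.22)–(1.28) pp. 181–183); CMP 122 (1989) 355–392 [Balaban1989LargeFieldII] ((1.79)–(1.80)
pp. 383–384); CMP 102 (1985) 277–309 [Balaban1985Variational] (Thm 1 p. 279).
-/

set_option autoImplicit false

noncomputable section

open scoped BigOperators ENNReal

namespace Summit.QuantumFields.YangMills.BalabanUVNodes.N20LCSLabelTowerAtResidualOfRecordHalves

open MeasureTheory
open Literature.MathematicalPhysics.QuantumFieldTheory.Balaban1983to89
open Literature.MathematicalPhysics.QuantumFieldTheory.Balaban1983to89.T4Continuum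
open Literature.MathematicalPhysics.QuantumFieldTheory.Balaban1983to89.B14.Eq218Concrete
open Literature.MathematicalPhysics.QuantumFieldTheory.Balaban1983to89.Node00
open Summit.QuantumFields.BalabanUV.T4Continuum.B16HistoryIndexedRepr (GoodClass)
open Summit.QuantumFields.BalabanUV.T4Continuum.B16HistoryReprChain
open Summit.QuantumFields.BalabanUV.T4Continuum.NE7b.PrefixExtraction (admS)
open Summit.QuantumFields.BalabanUV.T4Continuum.NE7b.LocalConditionalStability (LocCondStability PointwiseExtraction)
open Summit.QuantumFields.YangMills.BalabanUVNodes.N20LCSLabelTower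
open Summit.QuantumFields.YangMills.BalabanUVNodes.N20LCSLabelTowerClassWeight
open Summit.QuantumFields.YangMills.BalabanUVNodes.N20LCSLabelTowerByValue
open Summit.QuantumFields.YangMills.BalabanUVNodes.N20LCSLabelTowerPinnedLevels
open Summit.QuantumFields.YangMills.BalabanUVNodes.N20LCSLabelTowerAtResidualOfRecord (measurable_ωOfRecord_rec)
open Summit.QuantumFields.YangMills.BalabanUVNodes.N20ByValueTelescoping (pullAlong)
open ExpMeanLog (deltaSU)

variable (F : T4Family) (N : ℕ) [NeZero N] (ν : Stage7Numerics) (M : ℕ) (p : B12.RunParams) (g : ℕ → ℝ) (A₁ : ℝ)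

/-! ## §1 Keys rooted at step 0: the halves and the class weight bounds with no law ∕ measurability letter -/

section RootedAtZero

open Classical in
/-- ★★★ **`PointwiseExtraction ∧ LocCondStability` ON BAŁABAN's LABEL TOWER AT THE RESIDUAL OF RECORD, KEYS ROOTED AT THE FIRST STEP — NO LAW, NO
MEASURABILITY LETTER.**  With the `δ₀ > 0`, `C ≥ 0` of n20-d's cells Peierls bound: on every torus `F.P K` (`K ≥ 1`), for `g₀⁻² ≥ 4N`, every `E₀`, `A₁`,
every finite family `D` of χ₁-cubes with regularity letters on pairwise disjoint regions `R □` of `≤ m` plaquettes and `ε″ ≥ 0`; for every cutoff `Kc`,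
every label-family pattern `E` pinning `D` at level `0`, carriers `Mc 0 h = e^{a 0 h}·𝟙[∀ □ ∈ D, ∃ p′ ∈ R □, ε″ ≤ |Ū(∂p′) − 1|]`, `Mc j h = 1` (`j ≥ 1`), and
exponents with `e^{a 0 h}·(m·r)^{#D} ≤ e^{b 0 h}`, `a j h ≤ 0 ≤ b j h` (`j ≥ 1`): BOTH NAMED `Prop`s of `Spine/NE7b/LocalConditionalStability` hold for
`labelTowerOfRecord A₁ (zeta316OfRecord A₁)` in the state `rhoZeroOfRecord g₀ E₀` under the laws of record — module 28's `halves_labelTower_rootedAtZero`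
with K0b's two laws supplied.  Remaining displayed analytic input: the regularity letter `hreg` only. [folklore] -/
theorem halves_rec_rootedAtZero :
    ∃ δ₀ : ℝ, 0 < δ₀ ∧ ∃ C : ℝ, 0 ≤ C ∧ ∀ (_hK : 1 ≤ p.K) (g₀ E₀ : ℝ), 4 * N ≤ g₀⁻¹ ^ 2 → ∀ (A₁ : ℝ)
      (D : Finset (Iχ F ν p g 0)) (R : Iχ F ν p g 0 → Finset (Plaq (F.P p.K) 1)) (m : ℕ) (ε'' : ℝ), 0 ≤ ε'' →
        (∀ c ∈ D, (R c).card ≤ m) → (∀ c₁ ∈ D, ∀ c₂ ∈ D, c₁ ≠ c₂ → Disjoint (R c₁) (R c₂)) →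
        (∀ c ∈ D, ∀ V' : GaugeField (F.P p.K) 1 (SU N),
          (∀ p' ∈ R c, dist1 (GaugeField.plaqHol V' p') < ε'') → chiFactor F N ν p g 0 c V' = 1) →
      ∀ (Kc : ℕ) (E : (j : ℕ) → (Fin j → LabelPat F ν p g) → Finset (LbOfRecord F ν p g j))
        (Mc : (j : ℕ) → (Fin j → LabelPat F ν p g) → cfgOfRecord F N p.K j → ℝ) (a b : (j : ℕ) → (Fin j → LabelPat F ν p g) → ℝ),
        (∀ h t, t ∈ E 0 h → D ⊆ t.1) →
        (∀ (h : Fin 0 → LabelPat F ν p g) (U : cfgOfRecord F N p.K 0), Mc 0 h U = Real.exp (a 0 h) *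
          Set.indicator {U : GaugeField (F.P p.K) 0 (SU N) |
            ∀ c ∈ D, ∃ p' ∈ R c, ε'' ≤ dist1 (GaugeField.plaqHol ((avOfRecord F N p.K 0).avg U) p')} (fun _ => (1 : ℝ)) U) →
        (∀ (j : ℕ) (h : Fin j → LabelPat F ν p g), 1 ≤ j → Mc j h = fun _ => 1) →
        (∀ h : Fin 0 → LabelPat F ν p g, Real.exp (a 0 h) *
          ((m : ℝ) * Real.exp (C * δ₀ - δ₀ * g₀⁻¹ ^ 2 * (ε'' ^ 2 / (2 * (Fintype.card (Fin N) : ℝ))))) ^ D.card ≤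
            Real.exp (b 0 h)) →
        (∀ (j : ℕ) (h : Fin j → LabelPat F ν p g), 1 ≤ j → a j h ≤ 0 ∧ 0 ≤ b j h) →
        PointwiseExtraction (labelTowerOfRecord F N ν M p g A₁ (zeta316OfRecord F N ν M A₁)) (labelPattern F ν p g E) Kc
            (labelChi F N ν M p g A₁ (zeta316OfRecord F N ν M A₁)) Mc a ∧
          LocCondStability (labelTowerOfRecord F N ν M p g A₁ (zeta316OfRecord F N ν M A₁)) (labelPattern F ν p g E) Kc
            (lawOfRecord F N p.K) (rhoZeroOfRecord F N p.K g₀ E₀) Mc b := by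
  obtain ⟨δ₀, hδ₀, C, hC, h28⟩ := halves_labelTower_rootedAtZero F N ν M p g
  exact ⟨δ₀, hδ₀, C, hC, fun hK g₀ E₀ hg A₁ D R m ε'' hε hm hdisj hreg Kc E Mc a b hE0 hM0 hMj hb0 habj =>
    h28 hK g₀ E₀ hg A₁ (isZetaUnity_zeta316OfRecord A₁) (isZetaAbsLeOne_zeta316OfRecord A₁) D R m ε'' hε hm hdisj hreg Kc E Mc a b hE0 hM0
      hMj hb0 habj⟩

open Classical in
/-- ★★ **THE CLASS WEIGHT BOUND ON BAŁABAN's LABEL TOWER AT THE RESIDUAL OF RECORD, KEYS ROOTED AT THE FIRST STEP — NO LAW, NO MEASURABILITY LETTER**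
(module 28's `sum_admS_integral_le_labelTower_rootedAtZero` with the three letters supplied): the label histories of length `Kc + 1` whose first label's
(3.2) family contains `D` weigh, at level `Kc + 1`, at most ONE PEIERLS FACTOR PER PINNED CUBE `(m·e^{Cδ₀ − δ₀g₀⁻²ε″²∕(2N)})^{#D}` times the level-`0` mass
`∫ ρ₀ dU₀`. [folklore] -/
theorem sum_admS_integral_le_rec_rootedAtZero :
    ∃ δ₀ : ℝ, 0 < δ₀ ∧ ∃ C : ℝ, 0 ≤ C ∧ ∀ (_hK : 1 ≤ p.K) (g₀ E₀ : ℝ), 4 * N ≤ g₀⁻¹ ^ 2 → ∀ (A₁ : ℝ)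
      (D : Finset (Iχ F ν p g 0)) (R : Iχ F ν p g 0 → Finset (Plaq (F.P p.K) 1)) (m : ℕ) (ε'' : ℝ), 0 ≤ ε'' → 1 ≤ m →
        (∀ c ∈ D, (R c).card ≤ m) → (∀ c₁ ∈ D, ∀ c₂ ∈ D, c₁ ≠ c₂ → Disjoint (R c₁) (R c₂)) →
        (∀ c ∈ D, ∀ V' : GaugeField (F.P p.K) 1 (SU N),
          (∀ p' ∈ R c, dist1 (GaugeField.plaqHol V' p') < ε'') → chiFactor F N ν p g 0 c V' = 1) →
      ∀ (Kc : ℕ) (E : (j : ℕ) → (Fin j → LabelPat F ν p g) → Finset (LbOfRecord F ν p g j)), (∀ h t, t ∈ E 0 h → D ⊆ t.1) →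
        ∑ h ∈ admS (labelTowerOfRecord F N ν M p g A₁ (zeta316OfRecord F N ν M A₁)) (labelPattern F ν p g E) (Kc + 1),
            ∫ x, (labelTowerOfRecord F N ν M p g A₁ (zeta316OfRecord F N ν M A₁)).eterm (rhoZeroOfRecord F N p.K g₀ E₀) (Kc + 1) h x
              ∂(lawOfRecord F N p.K (Kc + 1)) ≤
          ((m : ℝ) * Real.exp (C * δ₀ - δ₀ * g₀⁻¹ ^ 2 * (ε'' ^ 2 / (2 * (Fintype.card (Fin N) : ℝ))))) ^ D.card *
            ∫ x, rhoZeroOfRecord F N p.K g₀ E₀ x ∂(fieldMeasure (F.P p.K) 0 (SU N)) := by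
  obtain ⟨δ₀, hδ₀, C, hC, h28⟩ := sum_admS_integral_le_labelTower_rootedAtZero F N ν M p g
  exact ⟨δ₀, hδ₀, C, hC, fun hK g₀ E₀ hg A₁ D R m ε'' hε hm1 hm hdisj hreg Kc E hE0 =>
    h28 hK g₀ E₀ hg A₁ (isZetaUnity_zeta316OfRecord A₁) (isZetaAbsLeOne_zeta316OfRecord A₁) (measurable_ωOfRecord_rec F N ν M p g A₁) D R m ε'' hε
      hm1 hm hdisj hreg Kc E hE0⟩

open Classical in
/-- **END2's `extractA` SHAPE, letter-free**: the class is at most `(m·r)^{#D}` times the FULL level-`(Kc+1)` sum (module 28's relative form). [folklore] -/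
theorem sum_admS_integral_le_mul_sum_adm_rec_rootedAtZero :
    ∃ δ₀ : ℝ, 0 < δ₀ ∧ ∃ C : ℝ, 0 ≤ C ∧ ∀ (_hK : 1 ≤ p.K) (g₀ E₀ : ℝ), 4 * N ≤ g₀⁻¹ ^ 2 → ∀ (A₁ : ℝ)
      (D : Finset (Iχ F ν p g 0)) (R : Iχ F ν p g 0 → Finset (Plaq (F.P p.K) 1)) (m : ℕ) (ε'' : ℝ), 0 ≤ ε'' → 1 ≤ m →
        (∀ c ∈ D, (R c).card ≤ m) → (∀ c₁ ∈ D, ∀ c₂ ∈ D, c₁ ≠ c₂ → Disjoint (R c₁) (R c₂)) →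
        (∀ c ∈ D, ∀ V' : GaugeField (F.P p.K) 1 (SU N),
          (∀ p' ∈ R c, dist1 (GaugeField.plaqHol V' p') < ε'') → chiFactor F N ν p g 0 c V' = 1) →
      ∀ (Kc : ℕ) (E : (j : ℕ) → (Fin j → LabelPat F ν p g) → Finset (LbOfRecord F ν p g j)), (∀ h t, t ∈ E 0 h → D ⊆ t.1) →
        ∑ h ∈ admS (labelTowerOfRecord F N ν M p g A₁ (zeta316OfRecord F N ν M A₁)) (labelPattern F ν p g E) (Kc + 1),
            ∫ x, (labelTowerOfRecord F N ν M p g A₁ (zeta316OfRecord F N ν M A₁)).eterm (rhoZeroOfRecord F N p.K g₀ E₀) (Kc + 1) h x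
              ∂(lawOfRecord F N p.K (Kc + 1)) ≤
          ((m : ℝ) * Real.exp (C * δ₀ - δ₀ * g₀⁻¹ ^ 2 * (ε'' ^ 2 / (2 * (Fintype.card (Fin N) : ℝ))))) ^ D.card *
            ∑ h ∈ (labelTowerOfRecord F N ν M p g A₁ (zeta316OfRecord F N ν M A₁)).adm (Kc + 1),
              ∫ x, (labelTowerOfRecord F N ν M p g A₁ (zeta316OfRecord F N ν M A₁)).eterm (rhoZeroOfRecord F N p.K g₀ E₀) (Kc + 1) h x
                ∂(lawOfRecord F N p.K (Kc + 1)) := by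
  obtain ⟨δ₀, hδ₀, C, hC, h28⟩ := sum_admS_integral_le_mul_sum_adm_labelTower_rootedAtZero F N ν M p g
  exact ⟨δ₀, hδ₀, C, hC, fun hK g₀ E₀ hg A₁ D R m ε'' hε hm1 hm hdisj hreg Kc E hE0 =>
    h28 hK g₀ E₀ hg A₁ (isZetaUnity_zeta316OfRecord A₁) (isZetaAbsLeOne_zeta316OfRecord A₁) (measurable_ωOfRecord_rec F N ν M p g A₁) D R m ε'' hε
      hm1 hm hdisj hreg Kc E hE0⟩

open Classical in
/-- **Overlapping letter regions, letter-free** (module 28 v1.1 §4): one Peierls factor per `K₀` pinned cubes. [folklore] -/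
theorem sum_admS_integral_le_rec_rootedAtZero_of_overlap :
    ∃ δ₀ : ℝ, 0 < δ₀ ∧ ∃ C : ℝ, 0 ≤ C ∧ ∀ (_hK : 1 ≤ p.K) (g₀ E₀ : ℝ), 4 * N ≤ g₀⁻¹ ^ 2 → ∀ (A₁ : ℝ)
      (D : Finset (Iχ F ν p g 0)) (R : Iχ F ν p g 0 → Finset (Plaq (F.P p.K) 1)) (m : ℕ) (ε'' : ℝ), 0 ≤ ε'' → 1 ≤ m →
        (∀ c ∈ D, (R c).card ≤ m) → ∀ (K₀ : ℕ), 1 ≤ K₀ → (∀ c ∈ D, (D.filter fun c' => ¬ Disjoint (R c) (R c')).card ≤ K₀) →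
        (∀ c ∈ D, ∀ V' : GaugeField (F.P p.K) 1 (SU N),
          (∀ p' ∈ R c, dist1 (GaugeField.plaqHol V' p') < ε'') → chiFactor F N ν p g 0 c V' = 1) →
      ∀ (Kc : ℕ) (E : (j : ℕ) → (Fin j → LabelPat F ν p g) → Finset (LbOfRecord F ν p g j)), (∀ h t, t ∈ E 0 h → D ⊆ t.1) →
        ∃ n : ℕ, D.card ≤ K₀ * n ∧
          ∑ h ∈ admS (labelTowerOfRecord F N ν M p g A₁ (zeta316OfRecord F N ν M A₁)) (labelPattern F ν p g E) (Kc + 1),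
              ∫ x, (labelTowerOfRecord F N ν M p g A₁ (zeta316OfRecord F N ν M A₁)).eterm (rhoZeroOfRecord F N p.K g₀ E₀) (Kc + 1) h x
                ∂(lawOfRecord F N p.K (Kc + 1)) ≤
            ((m : ℝ) * Real.exp (C * δ₀ - δ₀ * g₀⁻¹ ^ 2 * (ε'' ^ 2 / (2 * (Fintype.card (Fin N) : ℝ))))) ^ n *
              ∫ x, rhoZeroOfRecord F N p.K g₀ E₀ x ∂(fieldMeasure (F.P p.K) 0 (SU N)) := by
  obtain ⟨δ₀, hδ₀, C, hC, h28⟩ := sum_admS_integral_le_labelTower_rootedAtZero_of_overlap F N ν M p g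
  refine ⟨δ₀, hδ₀, C, hC, ?_⟩
  intro hK g₀ E₀ hg A₁ D R m ε'' hε hm1 hm K₀ hK₀ hover hreg Kc E hE0
  exact h28 hK g₀ E₀ hg A₁ (isZetaUnity_zeta316OfRecord A₁) (isZetaAbsLeOne_zeta316OfRecord A₁) (measurable_ωOfRecord_rec F N ν M p g A₁) D R m ε''
    hε hm1 hm K₀ hK₀ (fun c hc => by convert hover c hc using 3) hreg Kc E hE0

open Classical in
/-- **BY VALUE, letter-free** (module 29's `integral_sum_pullAlong_le_of_rootedAtZero`): under the bare Wilson state `ρ₀ = e^{−E₀}e^{−g₀⁻²A}` on the level-`0`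
torus, the total product weight of the label histories of length `Kc + 1` whose first label pins `D` is at most one Peierls factor per pinned cube. [folklore] -/
theorem integral_sum_pullAlong_le_rec_rootedAtZero :
    ∃ δ₀ : ℝ, 0 < δ₀ ∧ ∃ C : ℝ, 0 ≤ C ∧ ∀ (_hK : 1 ≤ p.K) (g₀ E₀ : ℝ), 4 * N ≤ g₀⁻¹ ^ 2 → ∀ (A₁ : ℝ)
      (D : Finset (Iχ F ν p g 0)) (R : Iχ F ν p g 0 → Finset (Plaq (F.P p.K) 1)) (m : ℕ) (ε'' : ℝ), 0 ≤ ε'' → 1 ≤ m →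
        (∀ c ∈ D, (R c).card ≤ m) → (∀ c₁ ∈ D, ∀ c₂ ∈ D, c₁ ≠ c₂ → Disjoint (R c₁) (R c₂)) →
        (∀ c ∈ D, ∀ V' : GaugeField (F.P p.K) 1 (SU N),
          (∀ p' ∈ R c, dist1 (GaugeField.plaqHol V' p') < ε'') → chiFactor F N ν p g 0 c V' = 1) →
      ∀ (Kc : ℕ) (E : (j : ℕ) → (Fin j → LabelPat F ν p g) → Finset (LbOfRecord F ν p g j)), (∀ h t, t ∈ E 0 h → D ⊆ t.1) →
        ∫ U, (∑ h ∈ admS (labelTowerOfRecord F N ν M p g A₁ (zeta316OfRecord F N ν M A₁)) (labelPattern F ν p g E) (Kc + 1),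
            pullAlong (fun j => (avOfRecord F N p.K j).avg) (labelChi F N ν M p g A₁ (zeta316OfRecord F N ν M A₁)) (Kc + 1) h U) *
              rhoZeroOfRecord F N p.K g₀ E₀ U ∂(fieldMeasure (F.P p.K) 0 (SU N)) ≤
          ((m : ℝ) * Real.exp (C * δ₀ - δ₀ * g₀⁻¹ ^ 2 * (ε'' ^ 2 / (2 * (Fintype.card (Fin N) : ℝ))))) ^ D.card *
            ∫ U, rhoZeroOfRecord F N p.K g₀ E₀ U ∂(fieldMeasure (F.P p.K) 0 (SU N)) := by
  obtain ⟨δ₀, hδ₀, C, hC, h29⟩ := integral_sum_pullAlong_le_of_rootedAtZero F N ν M p g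
  exact ⟨δ₀, hδ₀, C, hC, fun hK g₀ E₀ hg A₁ D R m ε'' hε hm1 hm hdisj hreg Kc E hE0 =>
    h29 hK g₀ E₀ hg A₁ (isZetaUnity_zeta316OfRecord A₁) (isZetaAbsLeOne_zeta316OfRecord A₁) (measurable_ωOfRecord_rec F N ν M p g A₁) D R m ε'' hε
      hm1 hm hdisj hreg Kc E hE0⟩

end RootedAtZero

/-! ## §2 Pinned levels: module 32 with the letters struck («LCS-j» at pinned levels `j ≥ 1` stays) -/

section PinnedLevels

open Classical in
/-- **THE HALVES ALONG A PATTERN PINNED AT THE LEVELS OF `J`, AT THE RESIDUAL OF RECORD** (module 32's `halves_labelTower_pinnedLevels` with K0b's two laws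
supplied): displayed inputs left = the regularity letters `hreg` and «LCS-j» (`hLS`, module 22's moment form) at the pinned levels. [folklore] -/
theorem halves_rec_pinnedLevels {ρ₀ : cfgOfRecord F N p.K 0 → ℝ} (hρ : (bddMeas (cfgOfRecord F N p.K 0)).Gd ρ₀) (h0 : ∀ U, 0 ≤ ρ₀ U)
    (J : Finset ℕ) (hJ : ∀ j ∈ J, j < p.K)
    (D : (j : ℕ) → Finset (Iχ F ν p g j)) (R : (j : ℕ) → Iχ F ν p g j → Finset (Plaq (F.P p.K) (j + 1))) (m : ℕ → ℕ) (ε'' : ℕ → ℝ)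
    (hε : ∀ j ∈ J, 0 ≤ ε'' j) (hm : ∀ j ∈ J, ∀ c ∈ D j, (R j c).card ≤ m j)
    (hdisj : ∀ j ∈ J, ∀ c₁ ∈ D j, ∀ c₂ ∈ D j, c₁ ≠ c₂ → Disjoint (R j c₁) (R j c₂))
    (hreg : ∀ j ∈ J, ∀ c ∈ D j, ∀ V' : GaugeField (F.P p.K) (j + 1) (SU N),
      (∀ p' ∈ R j c, dist1 (GaugeField.plaqHol V' p') < ε'' j) → chiFactor F N ν p g j c V' = 1)
    (α β C a₀ δ rate : ℕ → ℝ) (hα : ∀ j ∈ J, 0 < α j)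
    (hguard : ∀ j ∈ J, (((((F.P p.K).d + 2) * (F.P p.K).L : ℕ) : ℝ) ^ 2 / 4) * Real.sqrt (2 * (Fintype.card (Fin N) : ℝ) * α j) <
      deltaSU (Fin N))
    (hβ : ∀ j ∈ J, 0 ≤ β j) (hC : ∀ j ∈ J, 0 ≤ C j) (hδ0 : ∀ j ∈ J, 0 ≤ δ j)
    (hδ : ∀ j ∈ J, δ j * ((2 * (Fintype.card (Fin N) : ℝ) * (((F.P p.K).L : ℝ) ^ 2 + 6 * ((((F.P p.K).d + 2) * (F.P p.K).L : ℕ) : ℝ) ^ 2) ^ 2 +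
        2 / α j) * (((2 * (((F.P p.K).d + 3) * (F.P p.K).L + 2) + 1) ^ (F.P p.K).d * (F.P p.K).d ^ 2 : ℕ) : ℝ)) ≤ a₀ j)
    (hrate : ∀ j ∈ J, rate j = ((m j : ℝ) * Real.exp (C j * ((2 * (Fintype.card (Fin N) : ℝ) *
            (((F.P p.K).L : ℝ) ^ 2 + 6 * ((((F.P p.K).d + 2) * (F.P p.K).L : ℕ) : ℝ) ^ 2) ^ 2 + 2 / α j) *
          (((2 * (((F.P p.K).d + 3) * (F.P p.K).L + 2) + 1) ^ (F.P p.K).d * (F.P p.K).d ^ 2 : ℕ) : ℝ)) *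
          (((2 * (((F.P p.K).d + 3) * (F.P p.K).L + 2) + 1) ^ (F.P p.K).d * (F.P p.K).d ^ 2 : ℕ) : ℝ) * δ j -
            δ j * β j * (ε'' j ^ 2 / (2 * (Fintype.card (Fin N) : ℝ))))) ^ (D j).card)
    (hrate0 : ∀ j ∈ J, 0 < rate j)
    (K' : ℕ) (E : (j : ℕ) → (Fin j → LabelPat F ν p g) → Finset (LbOfRecord F ν p g j)) (hE : ∀ j ∈ J, ∀ h t, t ∈ E j h → D j ⊆ t.1)
    (hLS : ∀ j ∈ J, j < K' → ∀ h : Fin j → LabelPat F ν p g,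
      h ∈ admS (labelTowerOfRecord F N ν M p g A₁ (zeta316OfRecord F N ν M A₁)) (labelPattern F ν p g E) j →
      ∀ a : ℝ, 0 ≤ a → a ≤ a₀ j → ∀ X : Finset (Plaq (F.P p.K) j),
        ∫ U, Real.exp (a * β j * ∑ q ∈ X, (1 - reTr (GaugeField.plaqHol U q))) *
            (labelTowerOfRecord F N ν M p g A₁ (zeta316OfRecord F N ν M A₁)).eterm ρ₀ j h U ∂(lawOfRecord F N p.K j) ≤
          Real.exp (C j * a * X.card) * ∫ U, (labelTowerOfRecord F N ν M p g A₁ (zeta316OfRecord F N ν M A₁)).eterm ρ₀ j h U ∂(lawOfRecord F N p.K j)) :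
    PointwiseExtraction (labelTowerOfRecord F N ν M p g A₁ (zeta316OfRecord F N ν M A₁)) (labelPattern F ν p g E) K'
        (labelChi F N ν M p g A₁ (zeta316OfRecord F N ν M A₁))
        (fun j _ U => if j ∈ J then Set.indicator {U : cfgOfRecord F N p.K j |
            ∀ c ∈ D j, ∃ p' ∈ R j c, ε'' j ≤ dist1 (GaugeField.plaqHol ((avOfRecord F N p.K j).avg U) p')} (fun _ => (1 : ℝ)) U else 1)
        (fun _ _ => 0) ∧
      LocCondStability (labelTowerOfRecord F N ν M p g A₁ (zeta316OfRecord F N ν M A₁)) (labelPattern F ν p g E) K' (lawOfRecord F N p.K) ρ₀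
        (fun j _ U => if j ∈ J then Set.indicator {U : cfgOfRecord F N p.K j |
            ∀ c ∈ D j, ∃ p' ∈ R j c, ε'' j ≤ dist1 (GaugeField.plaqHol ((avOfRecord F N p.K j).avg U) p')} (fun _ => (1 : ℝ)) U else 1)
        (fun j _ => if j ∈ J then Real.log (rate j) else 0) :=
  halves_labelTower_pinnedLevels F N ν M p g (isZetaUnity_zeta316OfRecord A₁) (isZetaAbsLeOne_zeta316OfRecord A₁) hρ h0 J hJ D R m ε'' hε hm
    hdisj hreg α β C a₀ δ rate hα hguard hβ hC hδ0 hδ hrate hrate0 K' E hE hLS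

open Classical in
/-- **THE CLASS WEIGHT BOUND ALONG A PATTERN PINNED AT THE LEVELS OF `J`, AT THE RESIDUAL OF RECORD** (module 32's
`sum_admS_integral_le_labelTower_pinnedLevels`, letters struck): `≤ (Π_{j<K′, j∈J} rate j)·∫ρ₀ dU₀`, modulo `hreg` and «LCS-j» at the pinned levels. [folklore] -/
theorem sum_admS_integral_le_rec_pinnedLevels {ρ₀ : cfgOfRecord F N p.K 0 → ℝ} (hρ : (bddMeas (cfgOfRecord F N p.K 0)).Gd ρ₀) (h0 : ∀ U, 0 ≤ ρ₀ U)
    (J : Finset ℕ) (hJ : ∀ j ∈ J, j < p.K)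
    (D : (j : ℕ) → Finset (Iχ F ν p g j)) (R : (j : ℕ) → Iχ F ν p g j → Finset (Plaq (F.P p.K) (j + 1))) (m : ℕ → ℕ) (ε'' : ℕ → ℝ)
    (hε : ∀ j ∈ J, 0 ≤ ε'' j) (hm : ∀ j ∈ J, ∀ c ∈ D j, (R j c).card ≤ m j)
    (hdisj : ∀ j ∈ J, ∀ c₁ ∈ D j, ∀ c₂ ∈ D j, c₁ ≠ c₂ → Disjoint (R j c₁) (R j c₂))
    (hreg : ∀ j ∈ J, ∀ c ∈ D j, ∀ V' : GaugeField (F.P p.K) (j + 1) (SU N),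
      (∀ p' ∈ R j c, dist1 (GaugeField.plaqHol V' p') < ε'' j) → chiFactor F N ν p g j c V' = 1)
    (α β C a₀ δ rate : ℕ → ℝ) (hα : ∀ j ∈ J, 0 < α j)
    (hguard : ∀ j ∈ J, (((((F.P p.K).d + 2) * (F.P p.K).L : ℕ) : ℝ) ^ 2 / 4) * Real.sqrt (2 * (Fintype.card (Fin N) : ℝ) * α j) <
      deltaSU (Fin N))
    (hβ : ∀ j ∈ J, 0 ≤ β j) (hC : ∀ j ∈ J, 0 ≤ C j) (hδ0 : ∀ j ∈ J, 0 ≤ δ j)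
    (hδ : ∀ j ∈ J, δ j * ((2 * (Fintype.card (Fin N) : ℝ) * (((F.P p.K).L : ℝ) ^ 2 + 6 * ((((F.P p.K).d + 2) * (F.P p.K).L : ℕ) : ℝ) ^ 2) ^ 2 +
        2 / α j) * (((2 * (((F.P p.K).d + 3) * (F.P p.K).L + 2) + 1) ^ (F.P p.K).d * (F.P p.K).d ^ 2 : ℕ) : ℝ)) ≤ a₀ j)
    (hrate : ∀ j ∈ J, rate j = ((m j : ℝ) * Real.exp (C j * ((2 * (Fintype.card (Fin N) : ℝ) *
            (((F.P p.K).L : ℝ) ^ 2 + 6 * ((((F.P p.K).d + 2) * (F.P p.K).L : ℕ) : ℝ) ^ 2) ^ 2 + 2 / α j) *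
          (((2 * (((F.P p.K).d + 3) * (F.P p.K).L + 2) + 1) ^ (F.P p.K).d * (F.P p.K).d ^ 2 : ℕ) : ℝ)) *
          (((2 * (((F.P p.K).d + 3) * (F.P p.K).L + 2) + 1) ^ (F.P p.K).d * (F.P p.K).d ^ 2 : ℕ) : ℝ) * δ j -
            δ j * β j * (ε'' j ^ 2 / (2 * (Fintype.card (Fin N) : ℝ))))) ^ (D j).card)
    (hrate0 : ∀ j ∈ J, 0 < rate j)
    (K' : ℕ) (E : (j : ℕ) → (Fin j → LabelPat F ν p g) → Finset (LbOfRecord F ν p g j)) (hE : ∀ j ∈ J, ∀ h t, t ∈ E j h → D j ⊆ t.1)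
    (hLS : ∀ j ∈ J, j < K' → ∀ h : Fin j → LabelPat F ν p g,
      h ∈ admS (labelTowerOfRecord F N ν M p g A₁ (zeta316OfRecord F N ν M A₁)) (labelPattern F ν p g E) j →
      ∀ a : ℝ, 0 ≤ a → a ≤ a₀ j → ∀ X : Finset (Plaq (F.P p.K) j),
        ∫ U, Real.exp (a * β j * ∑ q ∈ X, (1 - reTr (GaugeField.plaqHol U q))) *
            (labelTowerOfRecord F N ν M p g A₁ (zeta316OfRecord F N ν M A₁)).eterm ρ₀ j h U ∂(lawOfRecord F N p.K j) ≤
          Real.exp (C j * a * X.card) * ∫ U, (labelTowerOfRecord F N ν M p g A₁ (zeta316OfRecord F N ν M A₁)).eterm ρ₀ j h U ∂(lawOfRecord F N p.K j)) :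
    ∑ h ∈ admS (labelTowerOfRecord F N ν M p g A₁ (zeta316OfRecord F N ν M A₁)) (labelPattern F ν p g E) K',
        ∫ x, (labelTowerOfRecord F N ν M p g A₁ (zeta316OfRecord F N ν M A₁)).eterm ρ₀ K' h x ∂(lawOfRecord F N p.K K') ≤
      (∏ j ∈ (Finset.range K').filter (· ∈ J), rate j) * ∫ U, ρ₀ U ∂(fieldMeasure (F.P p.K) 0 (SU N)) :=
  sum_admS_integral_le_labelTower_pinnedLevels F N ν M p g (isZetaUnity_zeta316OfRecord A₁) (isZetaAbsLeOne_zeta316OfRecord A₁)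
    (measurable_ωOfRecord_rec F N ν M p g A₁) hρ h0 J hJ D R m ε'' hε hm hdisj hreg α β C a₀ δ rate hα hguard hβ hC hδ0 hδ hrate hrate0 K' E hE
    hLS

open Classical in
/-- **SANITY, letter-free** (module 32's `sum_admS_integral_free_eq`): for the FREE pattern the class weight IS the total mass — the bound of
`sum_admS_integral_le_rec_pinnedLevels` at `J = ∅` holds with equality at the residual of record, with no hypothesis at all. [folklore] -/
theorem sum_admS_integral_free_eq_rec {ρ₀ : cfgOfRecord F N p.K 0 → ℝ} (hρ : (bddMeas (cfgOfRecord F N p.K 0)).Gd ρ₀) (K' : ℕ) :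
    ∑ h ∈ admS (labelTowerOfRecord F N ν M p g A₁ (zeta316OfRecord F N ν M A₁))
        (labelPattern F ν p g fun j _ => (Finset.univ : Finset (LbOfRecord F ν p g j))) K',
        ∫ x, (labelTowerOfRecord F N ν M p g A₁ (zeta316OfRecord F N ν M A₁)).eterm ρ₀ K' h x ∂(lawOfRecord F N p.K K') =
      ∫ U, ρ₀ U ∂(fieldMeasure (F.P p.K) 0 (SU N)) :=
  sum_admS_integral_free_eq F N ν M p g A₁ (isZetaUnity_zeta316OfRecord A₁) (isZetaAbsLeOne_zeta316OfRecord A₁)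
    (measurable_ωOfRecord_rec F N ν M p g A₁) hρ K'

end PinnedLevels

/-! ## §3 THE WALL ISOLATED: level `0` discharged inside («LCS-0» of record is g2's theorem), «LCS-j» displayed for the pinned levels `j ≥ 1` ONLY -/

section WallIsolated

open Classical in
/-- ★★★ **THE CLASS WEIGHT BOUND ON THE OBJECT OF RECORD WITH EXACTLY THE WALL DISPLAYED.**  In the state of record `ρ₀ = rhoZeroOfRecord g₀ E₀` (`g₀⁻² ≥ 4N`),
with the level-`0` moment letters FIXED to g2's («LCS-0» of record: `β 0 = g₀⁻²`, `a₀ 0 = 1∕12`, `C 0 = C₀`, the constant of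
`N20LCSAtRecordLevelZero.lcs_rhoZeroOfRecord`), the multi-level class weight bound of §2 holds with «LCS-j» ASSUMED ONLY AT THE PINNED LEVELS `j ≥ 1`
(`hLS⁺`) — level `0` is supplied inside by module 32's `lcs_zero_labelTower_of_record`.  So, by name and on Bałaban's label tower at the residual of record,
the (α)-road's Peierls bookkeeping for keys pinned at any finite set of levels rests on: the regularity letters `hreg`, the numeric side conditions, and
«LCS-j» for `j ≥ 1` — N20's first missing estimate ((A1c)), nothing else. [folklore] -/
theorem sum_admS_integral_le_rec_pinnedLevels_of_LCS_pos :
    ∃ C₀ : ℝ, 0 ≤ C₀ ∧ ∀ (g₀ E₀ : ℝ), 4 * N ≤ g₀⁻¹ ^ 2 →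
    ∀ (J : Finset ℕ), (∀ j ∈ J, j < p.K) →
    ∀ (D : (j : ℕ) → Finset (Iχ F ν p g j)) (R : (j : ℕ) → Iχ F ν p g j → Finset (Plaq (F.P p.K) (j + 1))) (m : ℕ → ℕ) (ε'' : ℕ → ℝ),
    (∀ j ∈ J, 0 ≤ ε'' j) → (∀ j ∈ J, ∀ c ∈ D j, (R j c).card ≤ m j) →
    (∀ j ∈ J, ∀ c₁ ∈ D j, ∀ c₂ ∈ D j, c₁ ≠ c₂ → Disjoint (R j c₁) (R j c₂)) →
    (∀ j ∈ J, ∀ c ∈ D j, ∀ V' : GaugeField (F.P p.K) (j + 1) (SU N),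
      (∀ p' ∈ R j c, dist1 (GaugeField.plaqHol V' p') < ε'' j) → chiFactor F N ν p g j c V' = 1) →
    ∀ (α β C a₀ δ rate : ℕ → ℝ), (∀ j ∈ J, 0 < α j) →
    (∀ j ∈ J, (((((F.P p.K).d + 2) * (F.P p.K).L : ℕ) : ℝ) ^ 2 / 4) * Real.sqrt (2 * (Fintype.card (Fin N) : ℝ) * α j) < deltaSU (Fin N)) →
    (∀ j ∈ J, 0 ≤ β j) → (∀ j ∈ J, 0 ≤ C j) → (∀ j ∈ J, 0 ≤ δ j) →
    (∀ j ∈ J, δ j * ((2 * (Fintype.card (Fin N) : ℝ) * (((F.P p.K).L : ℝ) ^ 2 + 6 * ((((F.P p.K).d + 2) * (F.P p.K).L : ℕ) : ℝ) ^ 2) ^ 2 +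
        2 / α j) * (((2 * (((F.P p.K).d + 3) * (F.P p.K).L + 2) + 1) ^ (F.P p.K).d * (F.P p.K).d ^ 2 : ℕ) : ℝ)) ≤ a₀ j) →
    (∀ j ∈ J, rate j = ((m j : ℝ) * Real.exp (C j * ((2 * (Fintype.card (Fin N) : ℝ) *
            (((F.P p.K).L : ℝ) ^ 2 + 6 * ((((F.P p.K).d + 2) * (F.P p.K).L : ℕ) : ℝ) ^ 2) ^ 2 + 2 / α j) *
          (((2 * (((F.P p.K).d + 3) * (F.P p.K).L + 2) + 1) ^ (F.P p.K).d * (F.P p.K).d ^ 2 : ℕ) : ℝ)) *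
          (((2 * (((F.P p.K).d + 3) * (F.P p.K).L + 2) + 1) ^ (F.P p.K).d * (F.P p.K).d ^ 2 : ℕ) : ℝ) * δ j -
            δ j * β j * (ε'' j ^ 2 / (2 * (Fintype.card (Fin N) : ℝ))))) ^ (D j).card) →
    (∀ j ∈ J, 0 < rate j) →
    -- the level-`0` letters are g2's: «LCS-0» of record
    β 0 = g₀⁻¹ ^ 2 → a₀ 0 = 1 / 12 → C 0 = C₀ →
    ∀ (K' : ℕ) (E : (j : ℕ) → (Fin j → LabelPat F ν p g) → Finset (LbOfRecord F ν p g j)), (∀ j ∈ J, ∀ h t, t ∈ E j h → D j ⊆ t.1) →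
    -- «LCS-j» at the pinned levels `j ≥ 1` ONLY — THE wall
    (∀ j ∈ J, 1 ≤ j → j < K' → ∀ h : Fin j → LabelPat F ν p g,
      h ∈ admS (labelTowerOfRecord F N ν M p g A₁ (zeta316OfRecord F N ν M A₁)) (labelPattern F ν p g E) j →
      ∀ a : ℝ, 0 ≤ a → a ≤ a₀ j → ∀ X : Finset (Plaq (F.P p.K) j),
        ∫ U, Real.exp (a * β j * ∑ q ∈ X, (1 - reTr (GaugeField.plaqHol U q))) *
            (labelTowerOfRecord F N ν M p g A₁ (zeta316OfRecord F N ν M A₁)).eterm (rhoZeroOfRecord F N p.K g₀ E₀) j h U ∂(lawOfRecord F N p.K j) ≤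
          Real.exp (C j * a * X.card) *
            ∫ U, (labelTowerOfRecord F N ν M p g A₁ (zeta316OfRecord F N ν M A₁)).eterm (rhoZeroOfRecord F N p.K g₀ E₀) j h U ∂(lawOfRecord F N p.K j)) →
    ∑ h ∈ admS (labelTowerOfRecord F N ν M p g A₁ (zeta316OfRecord F N ν M A₁)) (labelPattern F ν p g E) K',
        ∫ x, (labelTowerOfRecord F N ν M p g A₁ (zeta316OfRecord F N ν M A₁)).eterm (rhoZeroOfRecord F N p.K g₀ E₀) K' h x ∂(lawOfRecord F N p.K K') ≤
      (∏ j ∈ (Finset.range K').filter (· ∈ J), rate j) * ∫ U, rhoZeroOfRecord F N p.K g₀ E₀ U ∂(fieldMeasure (F.P p.K) 0 (SU N)) := by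
  obtain ⟨C₀, hC₀, hlcs0⟩ := lcs_zero_labelTower_of_record F N ν M p g
  refine ⟨C₀, hC₀, ?_⟩
  intro g₀ E₀ hg J hJ D R m ε'' hε hm hdisj hreg α β C a₀ δ rate hα hguard hβ hC hδ0 hδ hrate hrate0 hβ0 ha0 hC0 K' E hE hLSpos
  refine sum_admS_integral_le_rec_pinnedLevels F N ν M p g A₁ (rhoZeroOfRecord_good F N p.K g₀ E₀)
    (fun U => (rhoZeroOfRecord_pos F N p.K g₀ E₀ U).le) J hJ D R m ε'' hε hm hdisj hreg α β C a₀ δ rate hα hguard hβ hC hδ0 hδ hrate hrate0 K' E hE ?_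
  intro j hjJ hjK h hadm a ha0' haa X
  rcases Nat.eq_zero_or_pos j with hj0 | hjpos
  · subst hj0
    rw [hβ0, hC0]
    rw [ha0] at haa
    exact hlcs0 g₀ E₀ hg A₁ (zeta316OfRecord F N ν M A₁) h a ha0' haa X
  · exact hLSpos j hjJ hjpos hjK h hadm a ha0' haa X

end WallIsolated

end Summit.QuantumFields.YangMills.BalabanUVNodes.N20LCSLabelTowerAtResidualOfRecordHalves

end
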